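import Mathlib.Analysis.InnerProductSpace.Projection.Reflection
import Literature.Barriers.CriticalPhenomena.LongRangeTrivialityOnZ3MMSWalk
import Literature.Probability.LatticeModels.ConformalCovariance
import HarnessLib

/-!
# Audit (D-0021, generation 15) of `LongRangeTrivialityOnZ3Proofs.lean`: the contrary models of
# `LongRangeTrivialityOnZ3` are ANISOTROPIC in the limit — clause (ii) (rotations, Möbius) of the
# sub-problem is not tested by the barrier, and the lattice part of it is interaction-uniform

Barrier catalogue `Literature/Barriers/CriticalPhenomena/` (D-0021), sub-problem `Ising3DConformalLimit`
(`Literature.Probability.LatticeModels.CritIsing3DConformalLimit`: clauses (i) `S₂ > 0`, (ii) Möbius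
covariance — translations, `O(3)`, dilations, the unit inversion — and (iii) `U₄ ≢ 0`). Fifteenth audit
record (refuter, barrier-audit mode, generation 15, 2026-08-16) for the sibling
`LongRangeTrivialityOnZ3Proofs.lean` of the barrier `LongRangeTrivialityOnZ3`. The discharge
(`panis_variance_bound_holds`), the formal barrier (`LongRangeTrivialityOnZ3_holds`) and the records of
generations 1–14 are untouched; every declaration below is PROVED (no definition, no named fact, D-0026).
A separate leaf file is used so that the modules importing `…Proofs` / `…MMSWalk` are not rebuilt.

## Verdict: NARROWED — the barrier speaks to clause (iii) UNCONDITIONALLY, not to "(ii) ⟹ (iii)"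

Generations 2–14 catalogued the inputs a nearest-neighbour proof of clause (iii) must consume (bubble
divergence, `limsup χ_L/L^{3/2} > 0`, the strict window `η < 1/2`, locality / light tail, axis-isotropy
against decoupled planes, the in-field isotherm deficit). All of them are zero-field two-point, one-point or
structural inputs. None of them is a SYMMETRY input, and none of the fifteen generations asked whether the
contrary models of the barrier satisfy the OTHER clauses of the sub-problem. They do not:

### (G1) The contrary family is anisotropic in the limit (clause (ii) fails for every member) — on paper, with print

The couplings of `Z3Model` are Panis's `J_{x,y} = C₀|x-y|₁^{-3-α}` with the `ℓ¹` NORM ("Here, `|.|₁`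
refers to the `ℓ¹` norm on `ℝ^d`"; the reflection-positive examples of the source and of its sources are
all `ℓ¹`-based or products over coordinates) [cite: Panis2023Triviality, §1.2.1 (footnote to the examples (A1)–(A5)), p. 5, and §3.1 (examples (i)–(iv)), p. 13]
[cite: AizenmanDuminilCopinSidoravicius2015, §1.4 (the list "(nearest neighbor) … (exponential decay) … (power-law potentials) J = ‖x-y‖₁^{-α}"), p. 5].
For `α < 2` the small-momentum symbol of such a kernel is `E_J(k) = ∑ₓ J_{0,x}(1 - cos k·x) ∼ |k|^α c_α(k̂)`
with the ANGULAR factor `c_α(k̂) = C_α ∫_{S²} |k̂·θ|^α |θ|₁^{-3-α} dσ(θ) = (C_α/√3) ∫_{∂B₁} |k̂·u|^α dA(u)`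
(`∂B₁` the unit octahedron, cone measure), which is NOT constant on the sphere: numerically (this audit,
product Gauss quadrature `600 × 1200` on `S²`, `C_α` dropped) `c(e₁) : c((e₁+e₂)/√2) : c((e₁+e₂+e₃)/√3)`
is `2.1334 : 2.2424 : 2.2795` at `α = 1/2`, `1.33332 : 1.41419 : 1.44336` at `α = 1`, `0.98037 : 1.02593 :
1.04278` at `α = 1.4`; and EXACTLY at `α = 1` (face integrals of `|k̂·u|` over the eight faces of the
octahedron, each of area `√3/2`, at distance `1/√3` from the origin): `c₁(e₁) = 4/3`,
`c₁((e₁+e₂)/√2) = √2`, `c₁((e₁+e₂+e₃)/√3) = 5√3/6` — a spread of `8.25 %`. In general a symbol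
`|k|^α ∫|k̂·θ|^α dμ(θ)` with `0 < α < 2` is rotation invariant only if the (symmetrised) spectral measure
`μ` is, by uniqueness of the spectral measure of a symmetric `α`-stable law; `|θ|₁^{-3-α}dσ(θ)` is not.
In the regime of the barrier (`α < 3/2`, effective dimension `> 4`) the critical two-point function is
expected to follow the Green function of the `J`-walk ("If we expect the two-point function to behave, at
criticality, like the Green function of the random walk associated to `J` (as suggested by the infrared
bound …)" [cite: Panis2023Triviality, §1.2.1 (discussion following (A6′)), p. 7]) INCLUDING its angular profile
(the lace-expansion corrections to the inverse propagator are of smaller order in `|k|` above the upper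
critical dimension) — so the Gaussian
scaling limit of every contrary model has covariance `|x|^{α-3} h_α(x̂)` with `h_α` non-constant: it is
covariant under the hyperoctahedral group `B₃` and dilations, NOT under `O(3)`, hence not Möbius
covariant (`not_isMoebiusCovariant_of_twoPoint_ne` below: a two-point function taking different values at
two pairs of points at the same distance excludes `IsRotationInvariant`, hence `IsMoebiusCovariant Δ` for
every `Δ`). In print, for the percolation analogue and in the same words: kernels `∝ ‖x-y‖₁^{-d-α}` "are not
expected to yield rotationally-invariant scaling limits. As such, one should not be able to improve
(II.1.23) [up-to-constants Möbius covariance of the critical `k`-point function] to a first-order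
asymptotic equality without imposing additional assumptions on the model"
[cite: Hutchcroft2025, Remark II.1.18, p. 18]; "If the model is defined with respect to the isometry-invariant
kernel of the form `J(x,y) ∝ ‖x-y‖₂^{-d-α}` then the continuum limit is also expected to be invariant under
Euclidean isometries" [cite: Hutchcroft2025, §II.1.4 (paragraph before (II.1.19)), p. 16]; and, as a THEOREM
in high effective dimension, the scaling limit of large critical long-range percolation clusters is "the
integrated symmetric `α`-stable Lévy superprocess excursion associated to the Lévy measure with density
`(α/(d+α))‖x‖^{-d-α}`" in the MODEL'S norm `‖·‖` [cite: Hutchcroft2025HighDim, Theorem I.1.9, pp. 14–15] — rotation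
invariant exactly when the norm is Euclidean. (For the Ising members themselves the two-point ASYMPTOTICS
at spread-out parameter `1` are not in print — generation 11, (F3) — so (G1) is the mean-field expectation,
printed for the percolation cousin, not a theorem about `Z3Model`.)

Consequence. The contrary models of `LongRangeTrivialityOnZ3` (and of generation 7's perturbed family
`J_nn + ε|x-y|₁^{-3-α}`, and of generation 12's layered planes) witness "¬(ii) ∧ ¬(iii)" on `ℤ³`, not
"(i) ∧ (ii) ∧ ¬(iii)". Formally: for a conditional property `Φ m := (clause (ii) for m's critical
scaling limit) → HasNonGaussianSmearingZ3 m.coupling`, the barrier refutes `InteractionUniformZ3 Φ` only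
through a member at which the ANTECEDENT holds, and it exhibits none. So every argument and every route item
of the shape "(ii) [full `O(3)` / Möbius covariance of the nearest-neighbour limit] + interaction-uniform
steps ⟹ (iii)", or its contrapositive "(Möbius ∧ `U₄ ≡ 0`) ⟹ a two-point property of `J_nn`" — e.g. the
items `GaussianLimitIsCoulomb` / `GaussianLimitNotScreened` of `Theses/PerfectScreening.lean`,
`CovarianceUpgrade` of `Theses/MonotoneRG.lean`, `LimitsAreConformal` of
`Theses/MirrorHoelderCompactness.lean`, `TwoPointSpineComplement` of `Theses/InverseSquareTelemetry.lean` —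
is OUTSIDE the demonstrated reach of this barrier: `LongRangeTrivialityOnZ3` must not be cited against them.

### (G2) What does constrain "(ii) ⟹ (iii)": the continuum GFF (catalogued) and the ISOTROPIC long-range
### Gaussian lattice models (not catalogued) — on paper, from printed theorems

* Continuum: clauses (i) ∧ (ii) alone do not give (iii) — the generalised free family of any dimension
  `Δ` (`Literature.Probability.LatticeModels.gffFamily`, `exists_moebius_nondegenerate_gaussian`,
  `not_intrinsic_strengthening`) [cite: FrancescoMathieuSenechal1997, §4.3.1].
* Lattice, on `ℤ³`, isotropic AND Gaussian — the models a (ii)-conditioned nearest-neighbour argument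
  must be tested against: the SPREAD-OUT long-range Ising models with an isotropic symbol, e.g. the
  compound-zeta kernel `D = ∑_t U_L^{*t} t^{-1-α/2}/ζ(1+α/2)` (`U_L` uniform on the box of side `2L`;
  hypothesis (D2): "`1 - D̂(k) = v_α|k|^{α∧2}(1 + O(L^ε|k|^ε))`" with a SCALAR `v_α`), `0 < α < 3/2`
  (`d = 3 > d_c = 2(α ∧ 2)`), `L ≥ L₀(d)`: "`G_{p_c}(x) = (A/p_c)(γ_α/v_α)|x|^{-(d-α∧2)}(1 + O(L^ε)/|x|^ε)`"
  with `|·|` "the Euclidean norm" [cite: Sakai2020Crossover, Theorem 1.2 (= [ChenSakai2015, Thm 1.2]), eqs. (1.5), (2.3)–(2.5), (2.8), pp. 52–54]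
  [cite: ChenSakai2015, Theorem 1.2]. With this ISOTROPIC two-point asymptotics (`Δ = (3-α)/2 ∈ (3/4, 3/2)`,
  `ρ(δ) = const·δ^{-Δ}`), the pointwise `2n`-point functions converge, locally uniformly off the diagonals,
  to the Wick pairing sum of `‖xᵢ-xⱼ‖^{-2Δ}`: from above by the Gaussian (pairing) bound
  `S_{2n} ≤ 𝒢ₙ[S₂]` and from below by Aizenman's deviation-from-Wick inequality
  `|S_{2n} - 𝒢ₙ[S₂]| ≤ (3/2)∑|U₄|𝒢_{n-2}[S₂]` with the tree diagram bound, whose relative size at scale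
  `L` is `L³·L^{-4(3-α)}/L^{-2(3-α)} = L^{2α-3} → 0` (both valid for EVERY ferromagnetic pair interaction; tree:
  `Literature.Probability.LatticeModels.AizenmanWickBound`, `aizenman_nPoint_le_pairingSum_holds`)
  [cite: AizenmanCMP1982, Proposition 12.1, eq. (12.3)] [cite: AizenmanCDM2020, Proposition 7.2 eq. (7.1) and §10.1 eqs. (10.1)–(10.2), pp. 23, 31];
  the state at `β_c` is unique (`+` = free) because the decay of the free critical two-point function
  gives `M_LRO(β_c) = 0` [cite: AizenmanDuminilCopinSidoravicius2015, Theorem 1.2 and eq. defining M_LRO, p. 4].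
  Hence these models satisfy (i) and (ii) (Möbius covariance of the Wick family of `‖a-b‖^{-2Δ}`, any `Δ`:
  every pairing term carries the factor `∏ᵢ|φ′(xᵢ)|^{-Δ}`; for `n = 2, 4` this is the tree's
  `isMoebiusCovariant_gff`) and fail (iii) — "(ii) ∧ ¬(iii)" ON `ℤ³`, by Griffiths/Lebowitz/Newman/
  random-current tools only. Reflection positivity is not available for them (spread-out kernels; the lace
  expansion replaces the infrared bound — "a collection of non-solvable, and not necessarily reflection
  positive, models" [cite: AizenmanDuminilCopinSidoravicius2015, §1.5, p. 6]) and they are NOT in `Z3Model`;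
  a (ii)-conditioned argument for (iii) must therefore consume an input failing for them: reflection
  positivity / the transfer-matrix spectral representation, range one (`Z3Model`-membership of `J_nn`), or
  a quantitative use of `Δ_σ` near `1/2`.
* Within reflection-positive models: the EUCLIDEAN kernel `‖x-y‖₂^{-3-α}` is reflection positive on `ℤ³`
  through every lattice hyperplane (restriction to `ℤ³ ⊂ ℝ³` of the Osterwalder–Schrader-positive Riesz
  kernel `|x|^{-s}`, `s ≥ d - 2 = 1`: for each transverse momentum `q` the `x₁`-profile of its transverse
  Fourier transform is `∝ |q|^ν m^{-ν}K_ν(m|q|)`, `ν = (s-2)/2 > -1/2`, a Laplace transform of a positive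
  measure in `m = |x₁|`; derivation of this audit, not found in print, where only `ℓ¹` examples are listed),
  so Panis's Theorem 1.2 in its general form ((A1)–(A5), algebraic slices) makes it Gaussian for `α < 3/2`
  with `B(β_c) < ∞`; its limit is isotropic IF its critical two-point asymptotics exist with a scalar
  amplitude — open at spread-out parameter `1` exactly as for the `ℓ¹` family. Recommended: carry the
  Euclidean family alongside `Z3Model` in the parent block as the candidate "(ii) ∧ ¬(iii)" RP witness.

### (G3) PROVED here: the lattice part of clause (ii) is interaction-uniform; emergent isotropy is a
### light-tail phenomenon

* `LongRangeIsing.state_comp_signedPerm`, `interactionUniformZ3_hyperoctahedral`: for EVERY member of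
  `Z3Model`, every `β, h` and every observable `F`, `⟨F(σ ∘ ψ)⟩_{J,h,β} = ⟨F⟩_{J,h,β}` for all 48 signed
  coordinate permutations `ψ ∈ B₃` (term by term along the `B₃`-invariant boxes, from `expectIn_map_equiv`
  of the audited file; no sign condition on `β`, `J`). So `B₃`-covariance of any scaling limit of any
  member is automatic, and the ENTIRE model-dependent content of clause (ii) beyond dilations is ONE
  non-lattice rotation [cite: FriedliVelenik2017, Exercise 3.14, p. 115].
* `not_isRotationInvariant_of_twoPoint_ne`, `not_isMoebiusCovariant_of_twoPoint_ne`: a translation-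
  invariant family whose two-point function differs at two pairs of points at equal distance is not
  `O(3)`-invariant, hence not Möbius covariant for any `Δ` (Householder reflection
  `Submodule.reflection_sub`) — the hinge turning (G1)'s angular profile into `¬(ii)`.
* `LongRangeIsing.sum_box_mul_sq_inner_eq` (any `d`, any radius `R`): for a `B_d`-invariant weight `w`
  on `ℤ^d`, `∑_{x∈Λ_R} w(x)(k·x)² = (∑_{x∈Λ_R} w(x)x_{i₀}²)·|k|₂²` — the second-order symbol of a
  cubic-symmetric coupling is ISOTROPIC (off-diagonal second moments vanish by a sign flip, diagonal ones
  agree by a transposition). This is the mechanism of emergent rotational symmetry at the Gaussian level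
  for LIGHT-tailed couplings (`𝔪₂(J) < ∞`: `E_J(k) = (𝔪₂(J)/2d)|k|² + o(|k|²)`), printed for the
  percolation cousin as "if the kernel `J` is invariant under permutation of coordinates then `Σ` must be
  the identity matrix, so that the scaling limit is standard super-Brownian motion"
  [cite: Hutchcroft2025HighDim, Remark I.1.10, p. 16]; `Z3Model.sum_box_coupling_mul_sq_inner_eq` records it
  for every member (for the algebraic members the truncated second moment diverges with `R` when `α < 2`,
  and the leading symbol is the anisotropic `|k|^α c_α(k̂)` of (G1) instead). So rotational symmetry of
  the limit separates the nearest-neighbour model from the contrary family through the TAIL of the coupling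
  (`𝔪₂(J_nn) = 2d < ∞` versus `𝔪₂ = ∞`), the symmetry face of generation 7's light-tail separator — but,
  by (G2), it is an input of no use towards (iii) on its own.
* `quartic_cubicInvariant_not_isotropic`: beyond second order `B₃`-invariance forces nothing —
  `∑ᵢkᵢ⁴` (the fourth-order symbol of `J_nn` up to a factor) is not a function of `|k|₂`.

Search log (generation 15): local hybrid index ("long-range Ising critical scaling limit Gaussian
triviality effective dimension": textbooks only); the plain FTS daemon reset connections this session
(search-degraded: local FTS; arXiv leg answered: Sakai arXiv:1812.10275); held and READ at page level:
Panis arXiv:2309.05797 pp. 3, 5–7, 13; Hutchcroft arXiv:2508.18807 pp. 14–16 and arXiv:2508.18808 pp. 8,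
12, 16–18; Sakai, RIMS Kôkyûroku Bessatsu B79 (2020) pp. 51–54, 60–62 (Theorems 1.1–1.2, (D1)–(D3), (2.5));
Aizenman–Duminil-Copin–Sidoravicius arXiv:1311.1937 pp. 4–6; galaxy (pdf corpus, intelligent mode) for
reflection positivity of Euclidean power-law couplings: nothing relevant. No printed evasion of the formal
barrier; the narrowing is of its SCOPE relative to the sub-problem's clause (ii).

IDEA-CARD seed (for planners; also in the refuter's NOTES): Ising3DConformalLimit — the catalogued `ℤ³`
triviality barriers test no ROTATIONAL input: a line deriving `U₄ ≢ 0` from one emergent non-lattice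
rotation symmetry of the critical nearest-neighbour two-point asymptotics COMBINED with a reflection-
positivity / transfer-matrix or range-one step is blocked by no exhibited lattice model (the `ℓ¹` members
are anisotropic, the isotropic spread-out Gaussian models are not reflection positive); cheapest falsifier:
isotropic critical two-point asymptotics for the reflection-positive Euclidean family `‖x-y‖₂^{-3-α}`,
`α < 3/2` (then an RP, isotropic, Gaussian member exists and only the range-one step survives).

## References

* R. Panis, arXiv:2309.05797 (2023) = Ann. Probab. 54 (2026), §1.2.1 p. 5 (footnote: `|.|₁`), §3.1
  p. 13 (examples (i)–(iv)), Theorem 1.2 [Panis2023Triviality] (held; read pp. 3, 5–7, 13).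
* T. Hutchcroft, *Critical long-range percolation I: High effective dimension*, arXiv:2508.18807 (2025),
  Theorem I.1.9 (pp. 14–15), Remark I.1.10 (p. 16) [Hutchcroft2025HighDim] (held; read pp. 14–16).
* T. Hutchcroft, *Critical long-range percolation II: Low effective dimension*, arXiv:2508.18808 (2025),
  §II.1.4 (p. 16), Remark II.1.18 (p. 18) [Hutchcroft2025] (held; read pp. 8, 12, 16–18).
* A. Sakai, *Crossover phenomena in the critical behavior for long-range models with power-law
  couplings*, RIMS Kôkyûroku Bessatsu B79 (2020) 51–62, arXiv:1812.10275, Theorems 1.1–1.2, (D1)–(D3),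
  (2.5) [Sakai2020Crossover] (held; read pp. 51–54, 60–62); L.-C. Chen, A. Sakai, Ann. Probab. 43 (2015)
  639–681, Theorem 1.2 [ChenSakai2015] (through the former; not re-read).
* M. Aizenman, H. Duminil-Copin, V. Sidoravicius, Comm. Math. Phys. 334 (2015), arXiv:1311.1937,
  Theorem 1.2, §1.3–§1.4 [AizenmanDuminilCopinSidoravicius2015] (held; read pp. 4–6).
* M. Aizenman, Comm. Math. Phys. 86 (1982), Prop. 12.1 [AizenmanCMP1982]; M. Aizenman, arXiv:2112.04248,
  Prop. 7.2, §10.1 [AizenmanCDM2020] (as vendored in `AizenmanWickBound`; not re-read).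
* P. Di Francesco, P. Mathieu, D. Sénéchal, *Conformal Field Theory* (1997), §4.3.1
  [FrancescoMathieuSenechal1997] (as in `GeneralisedFreeFamily`).
* S. Friedli, Y. Velenik, *Statistical Mechanics of Lattice Systems* (2017), Exercise 3.14, p. 115
  [FriedliVelenik2017].

## Tree anchors

`expectIn_map_equiv`, `state`, `expectIn` (audited file); `Site.signedPerm`, `Site.signedPerm_apply`,
`Site.signedPerm_symm`, `Site.signedPerm_zero`, `signedPerm_mem_box_iff`, `l1Norm_signedPerm_sub`,
`signedPerm_image_box`, `algebraicCoupling_eq_of_l1Norm_eq`, `Z3Model.coupling`, `InteractionUniformZ3`; `IsTranslationInvariant`,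
`IsRotationInvariant`, `IsMoebiusCovariant` (`ConformalCovariance`); Mathlib `Submodule.reflection_sub`,
`Finset.sum_map`, `Finset.mem_map_equiv`, `Fin.sum_univ_three`.
-/

noncomputable section

namespace Literature.Barriers.CriticalPhenomena

open Literature.Probability.LatticeModels Literature.Probability.Percolation Filter Topology Finset

namespace LongRangeIsing

variable {d : ℕ}

/-! ### 1. Hyperoctahedral covariance of the free state — all observables, all `β`, `h` -/

section Hyperoctahedral

variable (J : Site d → Site d → ℝ) (β h : ℝ)

/-- **Finite-volume `B_d`-covariance, all observables**: for a signed coordinate permutation `ψ`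
preserving `J`, `⟨F(σ ∘ ψ)⟩_{Λ_L,J,h,β} = ⟨F⟩_{Λ_L,J,h,β}` (`ψ(Λ_L) = Λ_L`; Friedli–Velenik 2017,
Exercise 3.14 in finite volume). No sign condition on `β` or `J` is needed.
[cite: FriedliVelenik2017, Exercise 3.14, p. 115] -/
theorem expectIn_box_comp_signedPerm (π : Equiv.Perm (Fin d)) (ε : Fin d → ℤˣ)
    (hJ : ∀ x y, J (Site.signedPerm π ε x) (Site.signedPerm π ε y) = J x y) (L : ℕ)
    (F : SpinConfig (Site d) → ℝ) :
    expectIn J (box d L) β h (fun σ => F (σ ∘ Site.signedPerm π ε)) = expectIn J (box d L) β h F := by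
  -- `ψ(Λ_L) = Λ_L` (the tree's `box_map_signedPerm` of `PlusMinusReflectionInvariance`, re-derived from
  -- `signedPerm_image_box` to keep this leaf file's imports small)
  have hbox : (box d L).map (Site.signedPerm π ε).toEmbedding = box d L :=
    Finset.coe_injective (by rw [Finset.coe_map, Equiv.coe_toEmbedding, signedPerm_image_box])
  have h2 := expectIn_map_equiv J β h (Site.signedPerm π ε) hJ (box d L) F
  rwa [hbox] at h2

/-- **`B_d`-covariance of the infinite-volume free state, all observables**: for a signed coordinate
permutation `ψ` of `ℤ^d` preserving `J`, `⟨F(σ ∘ ψ)⟩_{J,h,β} = ⟨F⟩_{J,h,β}` for EVERY `F`, `β`, `h`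
(the two box sequences coincide term by term, so their `limUnder`s agree, junk values included;
Friedli–Velenik 2017, Exercise 3.14: "invariant under lattice rotations and reflections").
[cite: FriedliVelenik2017, Exercise 3.14, p. 115] -/
theorem state_comp_signedPerm (π : Equiv.Perm (Fin d)) (ε : Fin d → ℤˣ)
    (hJ : ∀ x y, J (Site.signedPerm π ε x) (Site.signedPerm π ε y) = J x y)
    (F : SpinConfig (Site d) → ℝ) :
    state J β h (fun σ => F (σ ∘ Site.signedPerm π ε)) = state J β h F := by
  rw [state, state]
  congr 1
  funext L
  exact expectIn_box_comp_signedPerm J β h π ε hJ L F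

/-- The algebraically decaying `ℓ¹` couplings `C₀|x-y|₁^{-d-α}` are `B_d`-invariant. [cite: Panis2023Triviality, §1.2.1 ((A3) and the ℓ¹ examples), p. 5] -/
theorem algebraicCoupling_signedPerm (C₀ α : ℝ) (π : Equiv.Perm (Fin d)) (ε : Fin d → ℤˣ)
    (x y : Site d) :
    algebraicCoupling d C₀ α (Site.signedPerm π ε x) (Site.signedPerm π ε y) =
      algebraicCoupling d C₀ α x y :=
  algebraicCoupling_eq_of_l1Norm_eq C₀ α (l1Norm_signedPerm_sub π ε x y)

/-- The nearest-neighbour coupling is `B_d`-invariant. [cite: Panis2023Triviality, §1.2.1 (nearest-neighbour example), p. 6] -/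
theorem nnCoupling_signedPerm (π : Equiv.Perm (Fin d)) (ε : Fin d → ℤˣ) (x y : Site d) :
    nnCoupling d (Site.signedPerm π ε x) (Site.signedPerm π ε y) = nnCoupling d x y := by
  unfold nnCoupling
  rw [l1Norm_signedPerm_sub]

end Hyperoctahedral

/-! ### 2. Second-order symbols of cubic-symmetric weights are isotropic; fourth-order ones are not -/

section Symbol

/-- Re-indexing a sum over a box by a signed coordinate permutation. [folklore] -/
theorem sum_box_comp_signedPerm (π : Equiv.Perm (Fin d)) (ε : Fin d → ℤˣ) (L : ℕ) (g : Site d → ℝ) :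
    ∑ x ∈ box d L, g (Site.signedPerm π ε x) = ∑ x ∈ box d L, g x := by
  have hbox : (box d L).map (Site.signedPerm π ε).toEmbedding = box d L :=
    Finset.coe_injective (by rw [Finset.coe_map, Equiv.coe_toEmbedding, signedPerm_image_box])
  conv_rhs => rw [← hbox]
  rw [Finset.sum_map]
  rfl

variable (w : Site d → ℝ)
  (hw : ∀ (π : Equiv.Perm (Fin d)) (ε : Fin d → ℤˣ) (x : Site d), w (Site.signedPerm π ε x) = w x)

include hw in
/-- Off-diagonal truncated second moments of a `B_d`-invariant weight vanish (flip the sign of one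
coordinate). [cite: Hutchcroft2025HighDim, Remark I.1.10, p. 16] -/
theorem sum_box_mul_coord_mul_coord_eq_zero (L : ℕ) {i j : Fin d} (hij : i ≠ j) :
    ∑ x ∈ box d L, w x * ((x i : ℝ) * (x j : ℝ)) = 0 := by
  set ε : Fin d → ℤˣ := Function.update 1 i (-1) with hε
  have hεi : ε i = -1 := by simp [hε]
  have hεj : ε j = 1 := by
    rw [hε, Function.update_of_ne hij.symm]
    rfl
  have hsum := sum_box_comp_signedPerm (1 : Equiv.Perm (Fin d)) ε L
    (fun x => w x * ((x i : ℝ) * (x j : ℝ)))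
  have hL : ∀ x : Site d, w (Site.signedPerm 1 ε x) *
      (((Site.signedPerm 1 ε x i : ℤ) : ℝ) * ((Site.signedPerm 1 ε x j : ℤ) : ℝ)) =
      -(w x * ((x i : ℝ) * (x j : ℝ))) := by
    intro x
    rw [hw, Site.signedPerm_apply, Site.signedPerm_apply, hεi, hεj]
    have e1 : ∀ l, (1 : Equiv.Perm (Fin d)).symm l = l := fun l => rfl
    simp only [e1, Units.val_neg, Units.val_one, Int.cast_mul, Int.cast_neg, Int.cast_one]
    ring
  simp only [hL, Finset.sum_neg_distrib] at hsum
  linarith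

include hw in
/-- Diagonal truncated second moments of a `B_d`-invariant weight agree (transpose two coordinates).
[cite: Hutchcroft2025HighDim, Remark I.1.10, p. 16] -/
theorem sum_box_mul_coord_sq_eq (L : ℕ) (i i₀ : Fin d) :
    ∑ x ∈ box d L, w x * ((x i : ℝ) * (x i : ℝ)) = ∑ x ∈ box d L, w x * ((x i₀ : ℝ) * (x i₀ : ℝ)) := by
  have hsum := sum_box_comp_signedPerm (Equiv.swap i i₀) (1 : Fin d → ℤˣ) L
    (fun x => w x * ((x i : ℝ) * (x i : ℝ)))
  have hL : ∀ x : Site d, w (Site.signedPerm (Equiv.swap i i₀) 1 x) *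
      (((Site.signedPerm (Equiv.swap i i₀) 1 x i : ℤ) : ℝ) *
        ((Site.signedPerm (Equiv.swap i i₀) 1 x i : ℤ) : ℝ)) =
      w x * ((x i₀ : ℝ) * (x i₀ : ℝ)) := by
    intro x
    rw [hw, Site.signedPerm_apply]
    simp only [Equiv.symm_swap, Equiv.swap_apply_left, Pi.one_apply, Units.val_one, one_mul]
  simp only [hL] at hsum
  exact hsum.symm

include hw in
/-- **Emergent isotropy at second order.** For a `B_d`-invariant weight `w` on `ℤ^d` (e.g. `w = J_{0,·}`
for any member of `Z3Model`, or any coupling invariant under signed coordinate permutations) and every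
radius `R`, the truncated second-order symbol is a multiple of the Euclidean form:
`∑_{x ∈ Λ_R} w(x) (k·x)² = (∑_{x ∈ Λ_R} w(x) x_{i₀}²) · ∑ᵢ kᵢ²`. When `𝔪₂(w) = ∑ₓ|x|²w(x) < ∞` this is
the leading small-`k` behaviour of `E_w(k) = ∑ₓ w(x)(1 - cos k·x)`, which is therefore isotropic — the
mechanism behind "if the kernel `J` is invariant under permutation of coordinates then `Σ` must be the
identity matrix" (Hutchcroft 2025, part I, Remark I.1.10, for `α > 2`). [cite: Hutchcroft2025HighDim, Remark I.1.10, p. 16] -/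
theorem sum_box_mul_sq_inner_eq (R : ℕ) (k : Fin d → ℝ) (i₀ : Fin d) :
    ∑ x ∈ box d R, w x * (∑ i, k i * (x i : ℝ)) ^ 2 =
      (∑ x ∈ box d R, w x * ((x i₀ : ℝ) * (x i₀ : ℝ))) * ∑ i, k i ^ 2 := by
  -- expand the square and exchange the sums
  have hexp : ∀ x : Site d, w x * (∑ i, k i * (x i : ℝ)) ^ 2 =
      ∑ i, ∑ j, k i * k j * (w x * ((x i : ℝ) * (x j : ℝ))) := by
    intro x
    rw [sq, Finset.sum_mul_sum, Finset.mul_sum]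
    refine Finset.sum_congr rfl fun i _ => ?_
    rw [Finset.mul_sum]
    refine Finset.sum_congr rfl fun j _ => ?_
    ring
  simp_rw [hexp]
  rw [Finset.sum_comm]
  have hinner : ∀ i : Fin d, ∑ x ∈ box d R, ∑ j, k i * k j * (w x * ((x i : ℝ) * (x j : ℝ))) =
      k i ^ 2 * ∑ x ∈ box d R, w x * ((x i₀ : ℝ) * (x i₀ : ℝ)) := by
    intro i
    rw [Finset.sum_comm]
    have hj : ∀ j : Fin d, ∑ x ∈ box d R, k i * k j * (w x * ((x i : ℝ) * (x j : ℝ))) =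
        if j = i then k i ^ 2 * ∑ x ∈ box d R, w x * ((x i₀ : ℝ) * (x i₀ : ℝ)) else 0 := by
      intro j
      rw [← Finset.mul_sum]
      split_ifs with hji
      · subst hji
        rw [sum_box_mul_coord_sq_eq w hw R j i₀]
        ring
      · rw [sum_box_mul_coord_mul_coord_eq_zero w hw R (Ne.symm hji), mul_zero]
    simp_rw [hj]
    rw [Finset.sum_ite_eq' Finset.univ i]
    simp
  simp_rw [hinner]
  rw [Finset.mul_sum]
  exact Finset.sum_congr rfl fun i _ => by ring

end Symbol

end LongRangeIsing

open LongRangeIsing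

/-! ### 3. On `Z3Model`: `B₃`-covariance is interaction-uniform -/

/-- Every coupling of the family is invariant under the signed coordinate permutations of `ℤ³`.
[cite: Panis2023Triviality, §1.2.1 ((A3) and the examples), pp. 5–6] -/
theorem Z3Model.coupling_signedPerm (m : Z3Model) (π : Equiv.Perm (Fin 3)) (ε : Fin 3 → ℤˣ)
    (x y : Site 3) :
    m.coupling (Site.signedPerm π ε x) (Site.signedPerm π ε y) = m.coupling x y := by
  cases m with
  | nearestNeighbour => exact nnCoupling_signedPerm π ε x y
  | algebraic C₀ α _ _ => exact algebraicCoupling_signedPerm C₀ α π ε x y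

/-- **The lattice part of clause (ii) is interaction-uniform on `ℤ³`.** For every member of `Z3Model`
(nearest-neighbour or `C₀|x-y|₁^{-3-α}`), every `β, h`, every observable `F` and every signed coordinate
permutation `ψ ∈ B₃`: `⟨F(σ ∘ ψ)⟩_{J,h,β} = ⟨F⟩_{J,h,β}`. Hence `B₃`-covariance of any scaling limit of any
member carries no information distinguishing the nearest-neighbour model; the model-dependent content of
clause (ii) beyond dilations is a single non-lattice rotation (audit generation 15, (G3)).
[cite: FriedliVelenik2017, Exercise 3.14, p. 115] -/
theorem interactionUniformZ3_hyperoctahedral :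
    InteractionUniformZ3 fun m => ∀ (π : Equiv.Perm (Fin 3)) (ε : Fin 3 → ℤˣ) (β h : ℝ)
      (F : SpinConfig (Site 3) → ℝ),
      state m.coupling β h (fun σ => F (σ ∘ Site.signedPerm π ε)) = state m.coupling β h F :=
  fun m π ε β h F => state_comp_signedPerm m.coupling β h π ε (m.coupling_signedPerm π ε) F

/-- **Truncated second moments of every member are isotropic** (all radii `R`): on `Z3Model`,
`∑_{x∈Λ_R} J_{0,x}(k·x)² = (∑_{x∈Λ_R} J_{0,x}x₀²)|k|₂²`. For the nearest-neighbour member (`R ≥ 1`) the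
sum is `(𝔪₂(J_nn)/3)|k|₂² = 2|k|₂²`, i.e. `E_{J_nn}(k) = ∑ₓJ_{0,x}(1 - cos k·x) = |k|₂² + O(|k|⁴)`,
isotropic at leading order; for the algebraic members the truncated moment diverges with
`R` when `α < 2` and the leading symbol is the anisotropic `|k|^α c_α(k̂)` instead (audit generation 15,
(G1), (G3)). [cite: Hutchcroft2025HighDim, Remark I.1.10, p. 16] -/
theorem Z3Model.sum_box_coupling_mul_sq_inner_eq (m : Z3Model) (R : ℕ) (k : Fin 3 → ℝ) :
    ∑ x ∈ box 3 R, m.coupling 0 x * (∑ i, k i * (x i : ℝ)) ^ 2 =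
      (∑ x ∈ box 3 R, m.coupling 0 x * ((x 0 : ℝ) * (x 0 : ℝ))) * ∑ i, k i ^ 2 :=
  sum_box_mul_sq_inner_eq (fun x => m.coupling 0 x)
    (fun π ε x => by
      have h := m.coupling_signedPerm π ε 0 x
      rwa [Site.signedPerm_zero] at h) R k 0

/-- **Beyond second order, cubic symmetry does not force isotropy**: the `B₃`-invariant quartic
`∑ᵢ kᵢ⁴` (the fourth-order symbol `∑_{|x|₁=1}(k·x)⁴ = 2∑ᵢkᵢ⁴` of the nearest-neighbour coupling, up to
the factor `2`) is not a function of `|k|₂`: compare `k = e₁` with `k = e₁ + e₂`. The `α`-homogeneous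
symbols `|k|^α c_α(k̂)`, `0 < α < 2`, of the `ℓ¹` members are the relevant instance (audit generation 15,
(G1)). [folklore] -/
theorem quartic_cubicInvariant_not_isotropic :
    ¬ ∃ c : ℝ, ∀ k : Fin 3 → ℝ, ∑ i, k i ^ 4 = c * (∑ i, k i ^ 2) ^ 2 := by
  rintro ⟨c, hc⟩
  have h1 := hc ![1, 0, 0]
  have h2 := hc ![1, 1, 0]
  simp [Fin.sum_univ_three] at h1 h2
  norm_num at h1 h2
  rw [← h1] at h2
  norm_num at h2

/-! ### 4. An anisotropic two-point function excludes clause (ii) -/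

section Clause2

/-- Translating a pair: `S₂(p, q) = S₂(p - q, 0)` for a translation-invariant family. [cite: FrancescoMathieuSenechal1997, §4.3.1] -/
theorem twoPoint_eq_sub_zero {S : CorrFamily 3} (hT : IsTranslationInvariant S)
    (p q : EuclideanSpace ℝ (Fin 3)) : S 2 ![p, q] = S 2 ![p - q, 0] := by
  have h1 := hT 2 (-q) ![p, q]
  have h2 : (fun i => (![p, q] : Fin 2 → EuclideanSpace ℝ (Fin 3)) i + -q) = ![p - q, 0] := by
    funext i
    fin_cases i <;> simp [sub_eq_add_neg]
  rw [h2] at h1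
  exact h1.symm

/-- **Translation + `O(3)` invariance make the two-point function radial**: `S₂(a,b) = S₂(a',b')`
whenever `‖a - b‖ = ‖a' - b'‖` (move `b` to the origin and apply the Householder reflection taking
`a - b` to `a' - b'`, `Submodule.reflection_sub`). [cite: FrancescoMathieuSenechal1997, §4.3.1 (eq. (4.55): the two-point function of a quasi-primary field depends on |x₁ - x₂| only)] -/
theorem twoPoint_eq_of_norm_sub_eq {S : CorrFamily 3} (hT : IsTranslationInvariant S)
    (hR : IsRotationInvariant S) {a b a' b' : EuclideanSpace ℝ (Fin 3)}
    (h : ‖a - b‖ = ‖a' - b'‖) : S 2 ![a, b] = S 2 ![a', b'] := by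
  rw [twoPoint_eq_sub_zero hT a b, twoPoint_eq_sub_zero hT a' b']
  set R : EuclideanSpace ℝ (Fin 3) ≃ₗᵢ[ℝ] EuclideanSpace ℝ (Fin 3) :=
    (Submodule.span ℝ {(a - b) - (a' - b')})ᗮ.reflection with hRdef
  have hRv : R (a - b) = a' - b' := Submodule.reflection_sub h
  have h3 := hR 2 R ![a - b, 0]
  have h4 : (fun i => R ((![a - b, 0] : Fin 2 → EuclideanSpace ℝ (Fin 3)) i)) = ![a' - b', 0] := by
    funext i
    fin_cases i <;> simp [hRv]
  rw [h4] at h3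
  exact h3.symm

/-- **An anisotropic two-point function excludes rotation invariance**: if a translation-invariant family
takes different values at two pairs of points at the same distance — as the candidate Gaussian limits
`|x|^{α-3}h_α(x̂)` of the `ℓ¹` members of `Z3Model` do (audit generation 15, (G1)) — it is not
`O(3)`-invariant. [cite: Hutchcroft2025, Remark II.1.18, p. 18] -/
theorem not_isRotationInvariant_of_twoPoint_ne {S : CorrFamily 3} (hT : IsTranslationInvariant S)
    {a b a' b' : EuclideanSpace ℝ (Fin 3)} (h : ‖a - b‖ = ‖a' - b'‖)
    (hne : S 2 ![a, b] ≠ S 2 ![a', b']) : ¬ IsRotationInvariant S :=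
  fun hR => hne (twoPoint_eq_of_norm_sub_eq hT hR h)

/-- … hence it is not Möbius covariant for ANY scaling dimension `Δ`: clause (ii) of
`CritIsing3DConformalLimit` fails for such a limit, whatever (i) and (iii) do. [cite: Hutchcroft2025, Remark II.1.18, p. 18] -/
theorem not_isMoebiusCovariant_of_twoPoint_ne {S : CorrFamily 3}
    {a b a' b' : EuclideanSpace ℝ (Fin 3)} (h : ‖a - b‖ = ‖a' - b'‖)
    (hne : S 2 ![a, b] ≠ S 2 ![a', b']) (Δ : ℝ) : ¬ IsMoebiusCovariant Δ S :=
  fun hM => not_isRotationInvariant_of_twoPoint_ne hM.1.1 h hne hM.1.2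

end Clause2

end Literature.Barriers.CriticalPhenomena

end
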